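import Mathlib
import HarnessLib
import Summits.HubbardSuperconductivity.HubbardSuperconductivity.Theorems.KLProgrammeKLRegimeCountertermV11Volume
import Summits.HubbardSuperconductivity.HubbardSuperconductivity.Theorems.KLProgrammeKLRegimeCountertermMsThresholds

/-!
# KL programme — child Counterterm (gen 3, `KLRegimeCountertermV11`, stmt-HubbardSuperconductivity-19825): the ASSEMBLY step

The registered stub of the counterterm child is `stub_ct_oneVolume : CtOneVolumeMsV11 G P Q` (`…CountertermV11Volume` §2): in the regime,
from the V11 hypothesis block beyond arbitrary thresholds `(Lh, Mh)`, build at ONE volume `(L₀, M₀)` an admissible frame whose local parts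
are within HALF the quadratic tolerance at every scale and every angle, with `L₀` so large that the (E3f) volume rate `Q.CL β n / L₀` fits
in the other half (the volume transfer `ct_volumeTransferMsV11` and the composition `countertermP2_klPredsV11_of_ms` are proved there).

This file separates the two halves of that stub:

* `CtContinuationMsV11 G P Q` — the output of the WHOLESALE CONTINUATION (k3c3-p2's `…CountertermContinuation`, reading lemmas of
  k3c3-p1's `…CountertermReading*` / `…CountertermPicardReading`, self-map `frameOK_of_multiSlot`, thresholds `ctRenMs_thresholds`)
  AT A GIVEN LARGE VOLUME: beyond its own thresholds `(Lc, Mc)` (chosen after `β`, `U`, `μ`, `c` and after the block) and the block's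
  `(Lh, Mh)` and the Matsubara threshold `Q.M0 β L`, at every volume `(L, M)` there is an admissible frame `K` (for the package `ctRenMs G`)
  with `|ν_n^{L,M}(K)(θ)| ≤ ½·ctCr G·|U|·Λ_n²/e₀` for all `n ≤ nScales β` and all real `θ`;
* `ctOneVolumeMsV11_of_continuation` — the VOLUME CHOICE: given the continuation, the construction volume `L₀` is chosen AFTER `β` by
  `exists_volume_threshold` (p2's `…CountertermMsThresholds` §4) with `a n = Q.CL β n ≥ 0` (`Q.WF`) against the positive half tolerances,
  beyond `Lc ⊔ Lh`; `M₀ := Mc L₀ ⊔ Mh L₀ ⊔ Q.M0 β L₀ ⊔ 1`; the frame is the continuation's frame at `(L₀, M₀)`.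

So the continuation supplier proves ONLY the per-volume fixed-point statement and never touches the (E3f) rate or the volume plumbing, and the
registered stub reads `stub_ct_oneVolume G P Q hG hP hQ := ctOneVolumeMsV11_of_continuation hG hQ (…continuation…)`.

Proofs only (real arithmetic and quantifier plumbing); nothing is asserted about the model.  Seat hubbard-kl-k3c5-p1 (gen 3, assembler of 19825).
-/

noncomputable section

namespace Summit.HubbardSuperconductivity.HubbardSuperconductivity.Theorems.KLRegimeSplit

set_option linter.dupNamespace false -- summit = problem name (single-conjunct summit), D-0017

open Real Finset Literature.MathematicalPhysics.QuantumLattice Literature.Probability.LatticeModels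
open Summit.HubbardSuperconductivity.HubbardSuperconductivity.Theorems.KLProgrammeLegKernels

/-- **The wholesale continuation AT A GIVEN LARGE VOLUME** (the analytic half of `CtOneVolumeMsV11`).  For the constants `(G, P, Q)`: there are
`c₁, U₀` such that, in the regime (`μ ∈ klWindowC`, `0 < U ≤ U₀`, `klBetaMin ≤ β ≤ exp (c/U²)`, `0 < c ≤ c₁`), from the V11 hypothesis block beyond
`(Lh, Mh)` one gets continuation thresholds `(Lc, Mc)` such that at EVERY volume `(L, M)` with `Lc ⊔ Lh ≤ L`, `Mc L ⊔ Mh L ⊔ Q.M0 β L ≤ M` there is an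
ADMISSIBLE frame `K` (package `ctRenMs G`) whose local parts at `(L, M)` are within HALF the quadratic tolerance at every scale `n ≤ nScales β` and
every real angle. -/
def CtContinuationMsV11 (G : GeoConsts) (P : SplitConsts) (Q : EngConsts) : Prop :=
    ∃ c₁ : ℝ, 0 < c₁ ∧ ∀ c : ℝ, 0 < c → c ≤ c₁ → ∃ U₀ : ℝ, 0 < U₀ ∧
      ∀ μ ∈ klWindowC, ∀ U : ℝ, 0 < U → U ≤ U₀ → ∀ β : ℝ, klBetaMin ≤ β → β ≤ Real.exp (c / U ^ 2) →
        ∀ (Lh : ℕ) (Mh : ℕ → ℕ), CtHypMsV11 G P Q β U μ Lh Mh →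
          ∃ (Lc : ℕ) (Mc : ℕ → ℕ), ∀ (L M : ℕ) [NeZero L] [NeZero M],
            Lc ≤ L → Lh ≤ L → Mc L ≤ M → Mh L ≤ M → Q.M0 β L ≤ M →
              ∃ K : TrigPolyC4v, FrameOK (ctRenMs G) U (nScales β) μ K ∧
                ∀ n : ℕ, n ≤ nScales β → ∀ θ : ℝ,
                  |klLocalPart L M β U μ K n θ| ≤ ctCr G * |U| * klScale klE0 n ^ 2 / klE0 / 2

/-- The half tolerance `½·ctCr G·|U|·Λ_n²/e₀` is positive for well-formed `G` and `U ≠ 0`. -/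
theorem half_tolerance_pos {G : GeoConsts} (hG : G.WF) {U : ℝ} (hU : U ≠ 0) (n : ℕ) :
    0 < ctCr G * |U| * klScale klE0 n ^ 2 / klE0 / 2 := by
  have hS : ∀ j, 0 ≤ G.S j := hG.2.2.2.2.2.2.2.2.2.2.2.2.2.2.2.2.2.1
  have hcr : 0 < ctCr G := by unfold ctCr; nlinarith [hS 0]
  have he0 : (0 : ℝ) < klE0 := by norm_num [klE0]
  have hsc : 0 < klScale klE0 n := by
    unfold klScale
    exact mul_pos he0 (inv_pos.mpr (pow_pos (by norm_num) n))
  have hUabs : 0 < |U| := abs_pos.mpr hU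
  positivity

/-- **ASSEMBLY: the one-volume construction from the continuation.**  Given the wholesale continuation at every large volume
(`CtContinuationMsV11`), the construction volume `L₀` is chosen AFTER `β`: beyond `Lc ⊔ Lh` and so large that `Q.CL β n / L₀ ≤ ½·tol_n` for the
finitely many `n ≤ nScales β` (`exists_volume_threshold`, `0 ≤ Q.CL β n` from `Q.WF`); `M₀ := Mc L₀ ⊔ Mh L₀ ⊔ Q.M0 β L₀ ⊔ 1`; the frame is the
continuation's frame at `(L₀, M₀)`.  This is exactly `CtOneVolumeMsV11 G P Q`. -/
theorem ctOneVolumeMsV11_of_continuation {G : GeoConsts} {P : SplitConsts} {Q : EngConsts} (hG : G.WF) (hQ : Q.WF)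
    (hcont : CtContinuationMsV11 G P Q) : CtOneVolumeMsV11 G P Q := by
  obtain ⟨c₁, hc₁, hc⟩ := hcont
  refine ⟨c₁, hc₁, fun c hc0 hcc => ?_⟩
  obtain ⟨U₀, hU₀, hmain⟩ := hc c hc0 hcc
  refine ⟨U₀, hU₀, fun μ hμ U hU hUle β hβ hβc Lh Mh hyp => ?_⟩
  obtain ⟨Lc, Mc, hvol⟩ := hmain μ hμ U hU hUle β hβ hβc Lh Mh hyp
  -- the construction volume: beyond `Lc ⊔ Lh`, with the (E3f) rate inside half the tolerance at every scale
  have hCL : ∀ n ≤ nScales β, 0 ≤ Q.CL β n := fun n _ => hQ.2.2.2.2.2.2.2 β n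
  have htol : ∀ n ≤ nScales β, 0 < ctCr G * |U| * klScale klE0 n ^ 2 / klE0 / 2 :=
    fun n _ => half_tolerance_pos hG hU.ne' n
  obtain ⟨L₀, hL₀pos, hL₀min, hrate⟩ := exists_volume_threshold hCL htol (max Lc Lh)
  have hLc : Lc ≤ L₀ := (le_max_left _ _).trans hL₀min
  have hLh : Lh ≤ L₀ := (le_max_right _ _).trans hL₀min
  -- the Matsubara cutoff: beyond every threshold, and positive
  set M₀ : ℕ := max (max (Mc L₀) (Mh L₀)) (max (Q.M0 β L₀) 1) with hM₀_def
  have hMc : Mc L₀ ≤ M₀ := (le_max_left _ _).trans (le_max_left _ _)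
  have hMh : Mh L₀ ≤ M₀ := (le_max_right _ _).trans (le_max_left _ _)
  have hM0 : Q.M0 β L₀ ≤ M₀ := (le_max_left _ _).trans (le_max_right _ _)
  have hM₀pos : 0 < M₀ := lt_of_lt_of_le one_pos ((le_max_right _ _).trans (le_max_right _ _))
  haveI : NeZero L₀ := ⟨Nat.pos_iff_ne_zero.mp hL₀pos⟩
  haveI : NeZero M₀ := ⟨Nat.pos_iff_ne_zero.mp hM₀pos⟩
  -- the continuation's frame at `(L₀, M₀)`
  obtain ⟨K, hK, hhalf⟩ := hvol L₀ M₀ hLc hLh hMc hMh hM0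
  refine ⟨K, hK, L₀, M₀, hL₀pos, hM₀pos, hLh, hMh, hM0, fun _ _ n hn => ⟨fun θ => ?_, hrate n hn⟩⟩
  exact hhalf n hn θ

end Summit.HubbardSuperconductivity.HubbardSuperconductivity.Theorems.KLRegimeSplit

end
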